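import Mathlib
import Literature.AlgebraicGeometry.Shioda1979.Statement
import Literature.AlgebraicGeometry.HodgeTheory.FermatShiodaCondition
import Literature.AlgebraicGeometry.Aoki1983.SemiStandard

/-!
# The level-39 torsion class is a semi-decomposable sextuple, and is `2`-torsion but non-zero modulo pairs and standard elements (THEOREM H39)

Solo-blind programme on `KontsevichZagierPeriods`, session 58; companion of `SoloBlindFermat33` /
`SoloBlindFermat33Lift66` (the class of level `33`, which dies only at level `66`).  The programme's
certificate (`paper/CERTIFICATE.md` §3f, THEOREM Z⁺⁺) lists `a₃₉` among the seven torsion Γ-classes that DIE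
in the one-level calculus `D_M = R_M + MU_M + T2_M` (reflection pairs, Gauss multiplication, two-term CM
coincidences) at their own level.  Under the Shioda–Aoki dictionary of `SoloBlindFermat33` (Hodge multisets =
effective Hodge-type Gamma-monomials; pairs = `R`, Aoki's standard elements `σ_{p,i}` = `MU`,
semi-decomposable sextuples = `T2`) this file makes the death and the non-triviality of `a₃₉` explicit as
kernel facts about multisets mod `39`:

* `s39 = {1, 16, 22, 7, 34, 37} = {1, 16, 22} ⊎ (−{32, 5, 2})` is a Hodge sextuple of the Fermat fourfold
  `X⁴₃₉` which is SEMI-DECOMPOSABLE (`isSemiDecomposable_s39`; the two triples have the same CM type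
  `ker χ₋₃₉`, cf. `SoloBlindFermatDomination.dom39_level39`), hence one of Shioda's prime generators of `M′₃₉`
  (`s39_mem_primeGenerators`): reachable by Shioda's programme at its own level — the death of `a₃₉` at `39`.
* `two_s39_certificate`: `2·s39 + σ_{3,2} + σ_{3,4} + σ_{3,5} + σ_{3,6} + {±3} + {±10} + {±13} + {±14}
  = σ_{3,1} + σ_{3,3} + σ_{13,1} + {±2} + {±5} + {±6} + {±7} + {±15} + {±17} + {±18}` — an explicit identity
  showing that `2·s39` IS stably generated by pairs and Aoki's standard elements (`two_s39_stably_standard`).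
* `s39_not_stably_standard`: `s39` itself is NOT (parity of the number of entries in
  `W = {1, 14, 25, 38} = ±{1, 14}`, even on every pair, `σ_{3,i}`, `σ_{13,i}`, odd on `s39`).

Together: modulo the span of pairs and standard elements the class of `s39` has order exactly `2` — it is
the `T`-part `T₃₉ ↠ B₃₉/(S₃₉ + D₃₉)` of [Aoki1983, Thm. D, Remark 5.4] (`μ′(39) = +1`), represented by a
semi-decomposable element; in Gamma-language, the two-term Beta coincidence `B(1/39,16/39) ~ B(2/39,5/39)`
(equal CM type) is a true period identity of level `39` that reflection and multiplication do not generate,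
while its square class they do.  In print the degree `39` is in no list of settled degrees of the Hodge
conjecture for Fermat varieties ([Aoki1983]/Aoki 2002 Thm. 1.2: `p^e`, `2p^e`, `2^a3^b5^c7^d`; da Silva 2021:
`m ≤ 20`, `21`, `27`, primes, `p²`, fourfolds of degree prime to `6`); for the class `s39` Shioda's Thm. II
(semi-decomposable ⇒ algebraic) applies directly, so no level-raising is needed here — contrast `a₃₃`.
Nothing in this file bears on `KZPeriodConjecture` itself (typed wall W5‴ ⊂ W3 of the certificate).

## References
* [Shioda1979PJA] T. Shioda, Proc. Japan Acad. 55A (1979) 111–114, §1 Definitions (i)–(iii).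
* [Shioda1979HodgeFermat] T. Shioda, Math. Ann. 245 (1979) 175–184, §4 (M′ₘ, Lemma 3), Thm. II.
* [Aoki1983] N. Aoki, Math. Ann. 266 (1983) 23–54, §5 p. 36 (σ_{p,i}), Thm. D and Remark 5.4 p. 38.
* [daSilva2021HodgeFermat] G. da Silva Jr., arXiv:2101.04739, §2–3.
* Programme files: `SoloBlindFermatDomination` (`dom39_level39`), `SoloBlindFermat33`, `SoloBlindFermat33Lift66`.
-/

open Literature.AlgebraicGeometry.HodgeTheory
open Literature.AlgebraicGeometry.HodgeTheory.FermatCharacter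
open Literature.AlgebraicGeometry.Shioda1979

namespace Summit.KontsevichZagierPeriods.KontsevichZagierPeriods.Theorems.SoloBlind.Fermat39

/-! ### The sextuple `s39` -/

/-- `s39 = {1, 16, 22} ⊎ {7, 34, 37}`: the effective representative of the torsion class `a₃₉`
(the two-term coincidence of the triples `(1,16,22)` and `(2,5,32)` of CM type `ker χ₋₃₉`). [folklore] -/
def s39 : Multiset (ZMod 39) := {1, 16, 22, 7, 34, 37}

/-- `s39` is a Hodge multiset of level `39` (`2 Σ⟨t a⟩ = 39 · 6` for all `24` units `t`). [folklore] -/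
theorem isHodgeMultiset_s39 : IsHodgeMultiset s39 := by
  unfold s39 IsHodgeMultiset mNormSum; decide +kernel

/-- `s39` is semi-decomposable: `{1,16,22} ⊎ {7,34,37}`, both triples summing to `0 mod 39`.
[cite: Shioda1979PJA, §1 Definition (iii)] -/
theorem isSemiDecomposable_s39 : IsSemiDecomposable s39 :=
  ⟨{1, 16, 22}, {7, 34, 37}, by decide, by decide, by decide, by decide, by decide⟩

/-- `s39` is one of Shioda's prime generators of `M′₃₉`: the death of `a₃₉` at its own level.
[cite: Shioda1979HodgeFermat, §4 p. 183 (definition of M′ₘ)] -/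
theorem s39_mem_primeGenerators : s39 ∈ primeGenerators 39 :=
  ⟨isHodgeMultiset_s39, Or.inr (Or.inr ⟨by decide, isSemiDecomposable_s39⟩)⟩

/-- Hence `s39 ∈ M′₃₉`. [cite: Shioda1979HodgeFermat, §4 p. 183] -/
theorem s39_mem_mPrime : s39 ∈ MPrime 39 := mem_mPrime_of_mem s39_mem_primeGenerators

/-! ### Pairs and standard elements of level `39` -/

/-- Aoki's standard element `σ_{13,i} = (i, i+3, …, i+36, −13 i)` of level `39` (`p = 13`, `d = 3`), as a
multiset. [cite: Aoki1983, §5 p. 36 (σ_{p,i})] -/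
def sigmaThirteen (i : ZMod 39) : Multiset (ZMod 39) :=
  (Multiset.range 13).map (fun k : ℕ ↦ i + (k : ZMod 39) * 3) + {-(13 * i)}

/-- The generators of `S₃₉ + D₃₉` in effective form: pairs `{a, −a}`, `σ_{3,i}`, `σ_{13,i}`.
[cite: Aoki1983, Thm. D p. 38] -/
def SDGen39 : Set (Multiset (ZMod 39)) :=
  {s | (∃ a : ZMod 39, s = {a, -a}) ∨ (∃ i : ZMod 39, s = Literature.AlgebraicGeometry.Aoki1983.sigmaThree 39 i) ∨
    (∃ i : ZMod 39, s = sigmaThirteen i)}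

/-- The left-hand side of the certificate: `σ_{3,2} + σ_{3,4} + σ_{3,5} + σ_{3,6} + {±3} + {±10} + {±13} + {±14}`. [folklore] -/
def certA : Multiset (ZMod 39) :=
  Literature.AlgebraicGeometry.Aoki1983.sigmaThree 39 2 + Literature.AlgebraicGeometry.Aoki1983.sigmaThree 39 4 +
    Literature.AlgebraicGeometry.Aoki1983.sigmaThree 39 5 + Literature.AlgebraicGeometry.Aoki1983.sigmaThree 39 6 +
    {3, -3} + {10, -10} + {13, -13} + {14, -14}

/-- The right-hand side of the certificate: `σ_{3,1} + σ_{3,3} + σ_{13,1} + {±2} + {±5} + {±6} + {±7} + {±15} + {±17} + {±18}`. [folklore] -/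
def certB : Multiset (ZMod 39) :=
  Literature.AlgebraicGeometry.Aoki1983.sigmaThree 39 1 + Literature.AlgebraicGeometry.Aoki1983.sigmaThree 39 3 +
    sigmaThirteen 1 + {2, -2} + {5, -5} + {6, -6} + {7, -7} + {15, -15} + {17, -17} + {18, -18}

/-- **The `2`-torsion certificate**: `2·s39 + certA = certB` as multisets mod `39`. [folklore] -/
theorem two_s39_certificate : s39 + s39 + certA = certB := by
  unfold s39 certA certB sigmaThirteen Literature.AlgebraicGeometry.Aoki1983.sigmaThree; decide +kernel

/-- `certA` lies in the monoid generated by pairs and standard elements. [folklore] -/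
theorem certA_mem_closure : certA ∈ AddSubmonoid.closure SDGen39 := by
  unfold certA
  refine add_mem (add_mem (add_mem (add_mem (add_mem (add_mem (add_mem ?_ ?_) ?_) ?_) ?_) ?_) ?_) ?_
  · exact AddSubmonoid.subset_closure (Or.inr (Or.inl ⟨2, rfl⟩))
  · exact AddSubmonoid.subset_closure (Or.inr (Or.inl ⟨4, rfl⟩))
  · exact AddSubmonoid.subset_closure (Or.inr (Or.inl ⟨5, rfl⟩))
  · exact AddSubmonoid.subset_closure (Or.inr (Or.inl ⟨6, rfl⟩))
  · exact AddSubmonoid.subset_closure (Or.inl ⟨3, rfl⟩)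
  · exact AddSubmonoid.subset_closure (Or.inl ⟨10, rfl⟩)
  · exact AddSubmonoid.subset_closure (Or.inl ⟨13, rfl⟩)
  · exact AddSubmonoid.subset_closure (Or.inl ⟨14, rfl⟩)

/-- `certB` lies in the monoid generated by pairs and standard elements. [folklore] -/
theorem certB_mem_closure : certB ∈ AddSubmonoid.closure SDGen39 := by
  unfold certB
  refine add_mem (add_mem (add_mem (add_mem (add_mem (add_mem (add_mem (add_mem (add_mem ?_ ?_) ?_) ?_) ?_)
    ?_) ?_) ?_) ?_) ?_
  · exact AddSubmonoid.subset_closure (Or.inr (Or.inl ⟨1, rfl⟩))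
  · exact AddSubmonoid.subset_closure (Or.inr (Or.inl ⟨3, rfl⟩))
  · exact AddSubmonoid.subset_closure (Or.inr (Or.inr ⟨1, rfl⟩))
  · exact AddSubmonoid.subset_closure (Or.inl ⟨2, rfl⟩)
  · exact AddSubmonoid.subset_closure (Or.inl ⟨5, rfl⟩)
  · exact AddSubmonoid.subset_closure (Or.inl ⟨6, rfl⟩)
  · exact AddSubmonoid.subset_closure (Or.inl ⟨7, rfl⟩)
  · exact AddSubmonoid.subset_closure (Or.inl ⟨15, rfl⟩)
  · exact AddSubmonoid.subset_closure (Or.inl ⟨17, rfl⟩)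
  · exact AddSubmonoid.subset_closure (Or.inl ⟨18, rfl⟩)

/-- **`2·s39` is stably generated by pairs and standard elements** (`2·a₃₉ = 0` in `A₃₉`: Kubert's
"torsion killed by `2`", here with an explicit witness). [cite: Aoki1983, Thm. D and Remark 5.4, p. 38] -/
theorem two_s39_stably_standard :
    ∃ A ∈ AddSubmonoid.closure SDGen39, ∃ B ∈ AddSubmonoid.closure SDGen39, s39 + s39 + A = B :=
  ⟨certA, certA_mem_closure, certB, certB_mem_closure, two_s39_certificate⟩

/-! ### Parity: `s39` itself is not stably standard -/

/-- The parity functional: the number of entries of `s` in `W = {1, 14, 25, 38} = ±{1, 14}`. [folklore] -/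
def wcount (s : Multiset (ZMod 39)) : ℕ := Multiset.card (s.filter fun x ↦ x = 1 ∨ x = 14 ∨ x = 25 ∨ x = 38)

/-- `wcount` is additive. [folklore] -/
theorem wcount_add (s t : Multiset (ZMod 39)) : wcount (s + t) = wcount s + wcount t := by
  simp [wcount, Multiset.filter_add]

/-- Pairs have even `wcount` (`W = −W`). [folklore] -/
theorem even_wcount_pair : ∀ a : ZMod 39, Even (wcount {a, -a}) := by
  unfold wcount; decide

/-- The standard elements `σ_{3,i}` have even `wcount` (in fact `0`), for every `i`. [folklore] -/
theorem even_wcount_sigmaThree :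
    ∀ i : ZMod 39, Even (wcount (Literature.AlgebraicGeometry.Aoki1983.sigmaThree 39 i)) := by
  unfold wcount Literature.AlgebraicGeometry.Aoki1983.sigmaThree; decide

/-- The standard elements `σ_{13,i}` have even `wcount`, for every `i`. [folklore] -/
theorem even_wcount_sigmaThirteen : ∀ i : ZMod 39, Even (wcount (sigmaThirteen i)) := by
  unfold wcount sigmaThirteen; decide

/-- Everything in the monoid generated by pairs and standard elements has even `wcount`. [folklore] -/
theorem even_wcount_of_mem_closure {s : Multiset (ZMod 39)} (h : s ∈ AddSubmonoid.closure SDGen39) :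
    Even (wcount s) := by
  induction h using AddSubmonoid.closure_induction with
  | mem x hx =>
    rcases hx with ⟨a, rfl⟩ | ⟨i, rfl⟩ | ⟨i, rfl⟩
    · exact even_wcount_pair a
    · exact even_wcount_sigmaThree i
    · exact even_wcount_sigmaThirteen i
  | zero => exact ⟨0, rfl⟩
  | add x y _ _ hx hy => rw [wcount_add]; exact hx.add hy

/-- `wcount s39 = 1` is odd. [folklore] -/
theorem odd_wcount_s39 : wcount s39 = 1 := by
  unfold wcount s39; decide

/-- **`s39` is not stably generated by pairs and standard elements**: no `A`, `B` in the monoid generated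
by `{a,−a}`, `σ_{3,i}`, `σ_{13,i}` satisfy `s39 + A = B`.  With `two_s39_stably_standard`: the class of the
semi-decomposable sextuple `s39` has order exactly `2` modulo `S₃₉ + D₃₉`, i.e. it generates the `T`-part of
[Aoki1983, Thm. D] at `m = 39`. [cite: Aoki1983, Thm. D and Remark 5.4, p. 38] -/
theorem s39_not_stably_standard :
    ¬ ∃ A ∈ AddSubmonoid.closure SDGen39, ∃ B ∈ AddSubmonoid.closure SDGen39, s39 + A = B := by
  rintro ⟨A, hA, B, hB, h⟩
  have hw := congrArg wcount h
  rw [wcount_add, odd_wcount_s39] at hw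
  obtain ⟨a, ha⟩ := even_wcount_of_mem_closure hA
  obtain ⟨b, hb⟩ := even_wcount_of_mem_closure hB
  omega

end Summit.KontsevichZagierPeriods.KontsevichZagierPeriods.Theorems.SoloBlind.Fermat39
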